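import Mathlib
import Summits.ValiantsHypothesis.ValiantsHypothesis.Theorems.LacunarySymmetroidMatrixDescartesCensusDefs
import Summits.ValiantsHypothesis.ValiantsHypothesis.Theorems.LacunarySymmetroidMatrixDescartesRolleSchurStep

/-!
# Tower graft line — THE RESIDUAL IS A CLASS DETERMINANT (bordered-minor identity and the residual budget)

Mechanism file for the line `Cruxes/WeakLifting/Lines/tower_graft.lean` (crux `WeakLifting` = stmt-ValiantsHypothesis-19561,
restricted sub-case `TowerWeakLifting`; S4/S5 side, NO stub is claimed here).  It also bears on the V1 line
`Cruxes/MatrixDescartes/Lines/rolle_schur_residual.lean` (crux 18050), whose RESIDUAL it identifies.  Companion file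
`…TowerGraftRankOneGraft.lean` draws the rank-one graft law from it.

**Bordered-minor identity (§1–§2).**  For a symmetric `G` of size `m+1` over a commutative domain with `det G ≠ 0`, ANY `H`,
and `u = adj(G) e₀`:  `det [[H, G_{·,succ}], [G_{succ,·}, 0]] = −det J · (adj G · H · adj G)₀₀ = ∓ uᵀ H u`,
`J = [[0,1],[1,0]]`, `(det J)² = 1` (`det_theta_eq`).  Proof: the doubled matrix `Φ = [[H,G],[G,0]]` satisfies the certificate
`Φ · [[0, p·adj G],[p·adj G, −adj G·H·adj G]] = p² • 1` and `det Φ = det J · p²` (`Φ = [[1,H],[0,G]]·J·[[1,0],[0,G]]`), so over a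
domain `adj Φ = det J • [[0, p·adj G],[p·adj G, −adj G·H·adj G]]` (`adjugate_doubled`); its corner cofactor at `(inr 0, inr 0)` is
the bordered minor (row/column replacement + a re-indexing `(Fin (m+1) ⊕ Fin m) ⊕ Unit ≃ Fin (m+1) ⊕ Fin (m+1)`).

**Same roots over `ℝ[X]` (§3–§4).**  `roots_det_theta_eq`: `roots (det Θ) = roots (uᵀ H u)` (`det J` is a unit constant).
With `H = ∑ₗ cₗ X^{dₗ} Sₗ` — e.g. `cₗ = dₗ − e`, `H = X G′ − e G`, the SHIFTED pencil of the tree's Rolle–Schur step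
(`…RolleSchurStep.lean`: `residual_eq`, `posRoots_det_le`) — `uᵀ H u` is the tree's RESIDUAL of `G` at `(e₀, e)`, while `Θ`,
re-indexed to `Fin (m+1+m)`, is a SYMMETRIC lacunary pencil on the SAME support `d` with letters
`Θₗ = [[cₗ Sₗ, (Sₗ)_{·,succ}], [(Sₗ)_{succ,·}, 0]]` (`theta_eq_pencil`, `theta_letter_isSymm`).  Hence
`posRoots_residual_le : PosRootLawOn (m+1+m) K B' d → det G ≠ 0 → Z₊(uᵀ H u) ≤ B'`: the residual is never harder than the
class census one size-doubling up, for EVERY shift (for 18050's line this reads `ResidualLaw ⟸` Conjecture B at size `2m−1`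
after the frame `w ↦ e₀` of `RolleSchur.exists_frame`; together with the tree's `ResidualLaw → IncrementLaw → B` the residual
law is B-equivalent in the window).

PRIOR ART in the tree: the desk's GRAFT CALCULUS for `MatrixDescartes` (`…GraftLaw.lean`, `…GraftToolkit.lean`, `…TailGraft*.lean`,
lines `Cruxes/MatrixDescartes/Lines/tail_graft*.lean`: one more letter buys `m` more alternations — the LOWER-bound direction) and the
Rolle–Schur files (`…RolleSchurStep/Compression/Telescope.lean`, line `rolle_schur_residual`); this file adds the identification of the
residual with a class determinant.  HONEST FRAMING: an exact determinant identity and its budget-relative reading; it proves nothing about S4 (`TowerGraftLawId`),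
S5 (`TowerGraftLaw`), TowerB, `WeakLifting`, Conjecture B, `ResidualLaw`, `MatrixDescartes` (18050) or `VP ≠ VNP`.  Def-free;
Mathlib + two tree files.  Exact-arithmetic cross-check of the identity for sizes ≤ 4 and arbitrary `H` in the seat's deposit
(`HOME/val-sym-lift-p3/g16/tools/check_theta.py`).  Seat: prover val-sym-lift-p3 g16, `--supports stmt-ValiantsHypothesis-19561`.
-/

-- `Summit.ValiantsHypothesis.ValiantsHypothesis.…` repeats a component by the D-0017 layout
-- (single-conjunct summit), which the `dupNamespace` linter flags; the name is mandated.
set_option linter.dupNamespace false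

namespace Summit.ValiantsHypothesis.ValiantsHypothesis.Theorems.KPlusLogSqLaw.TowerGraft

open Finset Polynomial Matrix
open scoped BigOperators Polynomial
open Summit.ValiantsHypothesis.ValiantsHypothesis.Theorems.LacunarySymmetroidMatrixDescartes (PosRootLawOn)

/-! ## §1 A bordered-minor identity over a commutative domain

For a symmetric `G : Matrix ι ι R`, any `H : Matrix ι ι R` and the doubled matrix `Φ = [[H, G], [G, 0]]`:
`Φ · N = det Φ • 1` with `N = det J • [[0, p·adj G], [p·adj G, −adj G·H·adj G]]`, `p = det G`, `J = [[0,1],[1,0]]`,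
so `adj Φ = N` when `p ≠ 0`; in particular the cofactor of `Φ` at a corner index `(inr k, inr k)` is
`−det J · (adj G · H · adj G) k k`. -/

section Generic

variable {ι : Type*} [Fintype ι] [DecidableEq ι] {R : Type*} [CommRing R]

/-- the block swap `J = [[0, 1], [1, 0]]` squares to the identity. [folklore] -/
theorem swapBlocks_mul_self :
    (Matrix.fromBlocks (0 : Matrix ι ι R) (1 : Matrix ι ι R) (1 : Matrix ι ι R) (0 : Matrix ι ι R)) * (Matrix.fromBlocks (0 : Matrix ι ι R) (1 : Matrix ι ι R) (1 : Matrix ι ι R) (0 : Matrix ι ι R)) = 1 := by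
  rw [Matrix.fromBlocks_multiply]
  simp

/-- hence `det J * det J = 1`. [folklore] -/
theorem det_swapBlocks_mul_self :
    (Matrix.fromBlocks (0 : Matrix ι ι R) (1 : Matrix ι ι R) (1 : Matrix ι ι R) (0 : Matrix ι ι R)).det * (Matrix.fromBlocks (0 : Matrix ι ι R) (1 : Matrix ι ι R) (1 : Matrix ι ι R) (0 : Matrix ι ι R)).det = 1 := by
  rw [← Matrix.det_mul, swapBlocks_mul_self, Matrix.det_one]

/-- `[[H, G], [G, 0]] = [[1, H], [0, G]] · J · [[1, 0], [0, G]]`. [folklore] -/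
theorem doubled_eq_mul (G H : Matrix ι ι R) :
    Matrix.fromBlocks H G G 0 =
      Matrix.fromBlocks (1 : Matrix ι ι R) H 0 G * Matrix.fromBlocks (0 : Matrix ι ι R) (1 : Matrix ι ι R) (1 : Matrix ι ι R) (0 : Matrix ι ι R) *
        Matrix.fromBlocks (1 : Matrix ι ι R) 0 0 G := by
  rw [Matrix.fromBlocks_multiply, Matrix.fromBlocks_multiply]
  simp

/-- `det [[H, G], [G, 0]] = det J · (det G)²`. [folklore] -/
theorem det_doubled (G H : Matrix ι ι R) :
    (Matrix.fromBlocks H G G 0).det =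
      (Matrix.fromBlocks (0 : Matrix ι ι R) (1 : Matrix ι ι R) (1 : Matrix ι ι R) (0 : Matrix ι ι R)).det * (G.det * G.det) := by
  rw [doubled_eq_mul, Matrix.det_mul, Matrix.det_mul, Matrix.det_fromBlocks_zero₂₁, Matrix.det_fromBlocks_zero₂₁]
  simp only [Matrix.det_one, one_mul]
  ring

/-- the adjugate certificate: `[[H, G], [G, 0]] · [[0, p·adj G], [p·adj G, −adj G·H·adj G]] = p² • 1`. [this work] -/
theorem doubled_mul_cert (G H : Matrix ι ι R) :
    Matrix.fromBlocks H G G 0 *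
        Matrix.fromBlocks (0 : Matrix ι ι R) (G.det • G.adjugate) (G.det • G.adjugate)
          (-(G.adjugate * H * G.adjugate)) =
      (G.det * G.det) • (1 : Matrix (ι ⊕ ι) (ι ⊕ ι) R) := by
  rw [Matrix.fromBlocks_multiply]
  have hGadj : G * G.adjugate = G.det • (1 : Matrix ι ι R) := Matrix.mul_adjugate G
  rw [← Matrix.fromBlocks_one, Matrix.fromBlocks_smul]
  refine Matrix.fromBlocks_inj.2 ⟨?_, ?_, ?_, ?_⟩
  · rw [Matrix.mul_zero, zero_add, Matrix.mul_smul, hGadj, smul_smul]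
  · rw [smul_zero, Matrix.mul_smul, Matrix.mul_neg, ← Matrix.mul_assoc, ← Matrix.mul_assoc, hGadj,
      Matrix.smul_mul, Matrix.one_mul, Matrix.smul_mul, add_neg_cancel]
  · rw [Matrix.mul_zero, Matrix.zero_mul, add_zero, smul_zero]
  · rw [Matrix.mul_smul, hGadj, Matrix.zero_mul, add_zero, smul_smul]

/-- **the adjugate of the doubled matrix** (domain, `det G ≠ 0`): `adj [[H,G],[G,0]] = det J • [[0, p·adj G],[p·adj G, −adj G·H·adj G]]`. [this work] -/
theorem adjugate_doubled [IsDomain R] (G H : Matrix ι ι R) (hG : G.det ≠ 0) :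
    (Matrix.fromBlocks H G G 0).adjugate =
      (Matrix.fromBlocks (0 : Matrix ι ι R) (1 : Matrix ι ι R) (1 : Matrix ι ι R) (0 : Matrix ι ι R)).det •
        Matrix.fromBlocks (0 : Matrix ι ι R) (G.det • G.adjugate) (G.det • G.adjugate)
          (-(G.adjugate * H * G.adjugate)) := by
  set Φ := Matrix.fromBlocks H G G 0 with hΦ
  set J := (Matrix.fromBlocks (0 : Matrix ι ι R) (1 : Matrix ι ι R) (1 : Matrix ι ι R) (0 : Matrix ι ι R)) with hJ
  set N := Matrix.fromBlocks (0 : Matrix ι ι R) (G.det • G.adjugate) (G.det • G.adjugate)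
    (-(G.adjugate * H * G.adjugate)) with hN
  have hdetΦ : Φ.det = J.det * (G.det * G.det) := det_doubled G H
  -- `Φ · (J.det • N) = det Φ • 1 = Φ · adj Φ`
  have h1 : Φ * (J.det • N) = Φ.det • (1 : Matrix (ι ⊕ ι) (ι ⊕ ι) R) := by
    rw [Matrix.mul_smul, hΦ, hN, doubled_mul_cert, smul_smul, ← hΦ, hdetΦ]
  have h2 : Φ * (Φ.adjugate - J.det • N) = 0 := by
    rw [Matrix.mul_sub, Matrix.mul_adjugate, h1, sub_self]
  -- multiply by `adj Φ` on the left: `det Φ • (adj Φ − J.det • N) = 0`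
  have h3 : Φ.det • (Φ.adjugate - J.det • N) = 0 := by
    have := congrArg (fun M => Φ.adjugate * M) h2
    simpa only [← Matrix.mul_assoc, Matrix.adjugate_mul, Matrix.smul_mul, Matrix.one_mul,
      Matrix.mul_zero] using this
  have hdet : Φ.det ≠ 0 := by
    rw [hdetΦ]
    have hJ1 : J.det * J.det = 1 := det_swapBlocks_mul_self
    exact mul_ne_zero (left_ne_zero_of_mul_eq_one hJ1) (mul_ne_zero hG hG)
  have h4 : Φ.adjugate - J.det • N = 0 := by
    ext i j
    have hij := congrFun (congrFun h3 i) j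
    simp only [Matrix.smul_apply, smul_eq_mul, Matrix.zero_apply, mul_eq_zero] at hij
    rcases hij with h | h
    · exact absurd h hdet
    · simpa using h
  exact sub_eq_zero.1 h4

/-- the corner cofactor of the doubled matrix: `adj Φ (inr k) (inr k) = −det J · (adj G · H · adj G) k k`. [this work] -/
theorem adjugate_doubled_inr_inr [IsDomain R] (G H : Matrix ι ι R) (hG : G.det ≠ 0) (k : ι) :
    (Matrix.fromBlocks H G G 0).adjugate (Sum.inr k) (Sum.inr k) =
      -((Matrix.fromBlocks (0 : Matrix ι ι R) (1 : Matrix ι ι R) (1 : Matrix ι ι R) (0 : Matrix ι ι R)).det * (G.adjugate * H * G.adjugate) k k) := by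
  rw [adjugate_doubled G H hG, Matrix.smul_apply, Matrix.fromBlocks_apply₂₂, Matrix.neg_apply, smul_eq_mul,
    mul_neg]

/-- Clearing column `k` against the unit row `k`: after row `k` is replaced by `e_k`, replacing column `k` by `e_k`
as well does not change the determinant (row operations `row_i ← row_i − A_{ik} row_k`). [folklore] -/
theorem det_updateRow_single_eq_det_updateCol (A : Matrix ι ι R) (k : ι) :
    (A.updateRow k (Pi.single k 1)).det =
      ((A.updateRow k (Pi.single k 1)).updateCol k (Pi.single k 1)).det := by
  refine Matrix.det_eq_of_forall_row_eq_smul_add_const (fun i => if i = k then 0 else A i k) k (if_pos rfl) ?_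
  intro i j
  by_cases hik : i = k
  · subst hik
    by_cases hjk : j = i
    · subst hjk; simp [Matrix.updateRow_apply]
    · simp [Matrix.updateRow_apply, hjk]
  · by_cases hjk : j = k
    · subst hjk; simp [Matrix.updateRow_apply, hik]
    · simp [Matrix.updateRow_apply, hik, hjk]

end Generic

/-! ## §2 The corner cofactor of the doubled matrix is the determinant of the bordered minor `Θ`

For `G, H : Matrix (Fin (m+1)) (Fin (m+1)) R`: `Θ = [[H, G_{·,1..m}], [G_{1..m,·}, 0]]` on `Fin (m+1) ⊕ Fin m`, and
`adj [[H, G], [G, 0]] (inr 0) (inr 0) = det Θ`. -/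

section Corner

variable {R : Type*} [CommRing R] {m : ℕ}

/-- the re-indexing `(Fin (m+1) ⊕ Fin m) ⊕ Unit ≃ Fin (m+1) ⊕ Fin (m+1)`: `inl (inl i) ↦ inl i`, `inl (inr j) ↦ inr j.succ`,
`inr () ↦ inr 0` (library equivalences only). [folklore] -/
theorem corner_reindex_apply (x : (Fin (m + 1) ⊕ Fin m) ⊕ Unit) :
    ((Equiv.sumAssoc (Fin (m + 1)) (Fin m) Unit).trans
        (Equiv.sumCongr (Equiv.refl (Fin (m + 1)))
          (((Equiv.optionEquivSumPUnit (Fin m)).symm.trans (finSuccEquiv m).symm)))) x =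
      Sum.elim (Sum.elim (fun i => Sum.inl i) (fun j => Sum.inr j.succ)) (fun _ => Sum.inr 0) x := by
  rcases x with ((i | j) | u)
  · simp
  · simp [finSuccEquiv_symm_some]
  · simp [finSuccEquiv_symm_none]

/-- **corner cofactor = bordered minor**: for the doubled matrix `Φ = [[H, G], [G, 0]]`,
`det (Φ with row and column (inr 0) replaced by the unit vector) = det [[H, G_{·,succ}], [G_{succ,·}, 0]]`. [this work] -/
theorem det_corner_eq_det_theta (G H : Matrix (Fin (m + 1)) (Fin (m + 1)) R) :
    (((Matrix.fromBlocks H G G 0).updateRow (Sum.inr 0) (Pi.single (Sum.inr 0) 1)).updateCol (Sum.inr 0)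
        (Pi.single (Sum.inr 0) 1)).det =
      (Matrix.fromBlocks H (G.submatrix id Fin.succ) (G.submatrix Fin.succ id) (0 : Matrix (Fin m) (Fin m) R)).det := by
  set ρ := (Equiv.sumAssoc (Fin (m + 1)) (Fin m) Unit).trans
        (Equiv.sumCongr (Equiv.refl (Fin (m + 1)))
          (((Equiv.optionEquivSumPUnit (Fin m)).symm.trans (finSuccEquiv m).symm))) with hρ
  set B := ((Matrix.fromBlocks H G G 0).updateRow (Sum.inr 0) (Pi.single (Sum.inr (0 : Fin (m + 1))) (1 : R))).updateCol
      (Sum.inr 0) (Pi.single (Sum.inr (0 : Fin (m + 1))) (1 : R)) with hB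
  have hsub : B.submatrix ρ ρ =
      Matrix.fromBlocks (Matrix.fromBlocks H (G.submatrix id Fin.succ) (G.submatrix Fin.succ id)
        (0 : Matrix (Fin m) (Fin m) R)) 0 0 (1 : Matrix Unit Unit R) := by
    ext x y
    rw [Matrix.submatrix_apply, corner_reindex_apply, corner_reindex_apply]
    rcases x with ((i | i) | u) <;> rcases y with ((j | j) | v) <;>
      simp [hB, Matrix.updateRow_apply, Fin.succ_ne_zero]
  rw [← Matrix.det_submatrix_equiv_self ρ B, hsub, Matrix.det_fromBlocks_zero₂₁, Matrix.det_one, mul_one]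

/-- **BORDERED-MINOR IDENTITY**: over a commutative domain with `det G ≠ 0`, `det Θ = −det J · (adj G · H · adj G) 0 0` for `Θ = [[H, G_{·,succ}], [G_{succ,·}, 0]]` (`G` symmetric, `H` arbitrary). [this work] -/
theorem det_theta_eq [IsDomain R] (G H : Matrix (Fin (m + 1)) (Fin (m + 1)) R) (hG : G.det ≠ 0) :
    (Matrix.fromBlocks H (G.submatrix id Fin.succ) (G.submatrix Fin.succ id) (0 : Matrix (Fin m) (Fin m) R)).det =
      -((Matrix.fromBlocks (0 : Matrix (Fin (m + 1)) (Fin (m + 1)) R) (1 : Matrix (Fin (m + 1)) (Fin (m + 1)) R)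
          (1 : Matrix (Fin (m + 1)) (Fin (m + 1)) R) (0 : Matrix (Fin (m + 1)) (Fin (m + 1)) R)).det *
        (G.adjugate * H * G.adjugate) 0 0) := by
  rw [← det_corner_eq_det_theta, ← det_updateRow_single_eq_det_updateCol, ← Matrix.adjugate_apply,
    adjugate_doubled_inr_inr G H hG]

end Corner

/-! ## §3 The corner entry of `adj G · H · adj G` is the residual form `uᵀ H u`, `u = adj(G) e₀` -/

section Residual

variable {n : Type*} [Fintype n] [DecidableEq n] {R : Type*} [CommRing R]

/-- for symmetric `A`: `(A · H · A) k k = (A e_k)ᵀ H (A e_k)`. [folklore] -/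
theorem mul_mul_apply_eq_dotProduct (A H : Matrix n n R) (hA : A.IsSymm) (k : n) :
    (A * H * A) k k = (A *ᵥ Pi.single k 1) ⬝ᵥ (H *ᵥ (A *ᵥ Pi.single k 1)) := by
  rw [Matrix.mulVec_single_one]
  simp only [Matrix.mul_apply, dotProduct, Matrix.mulVec, Matrix.col_apply, Finset.sum_mul]
  rw [Finset.sum_comm]
  refine Finset.sum_congr rfl fun i _ => ?_
  rw [Finset.mul_sum]
  refine Finset.sum_congr rfl fun j _ => ?_
  rw [show A k i = A i k from by rw [← hA.apply i k]]
  ring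

end Residual

/-! ## §4 Over `ℝ[X]`: the bordered minor and the residual form have the same roots -/

section OverPolynomials

variable {m : ℕ}

/-- **THE BORDERED-MINOR IDENTITY, root form.**  For a symmetric `G : Matrix (Fin (m+1)) (Fin (m+1)) ℝ[X]` with
`det G ≠ 0`, any `H`, and `u = adj(G) e₀`: the determinant of `Θ = [[H, G_{·,succ}], [G_{succ,·}, 0]]` is a UNIT multiple
(`±1`) of the residual form `uᵀ H u`; in particular both have the same roots. [this work] -/
theorem roots_det_theta_eq (G H : Matrix (Fin (m + 1)) (Fin (m + 1)) ℝ[X]) (hG : G.IsSymm) (hdet : G.det ≠ 0) :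
    (Matrix.fromBlocks H (G.submatrix id Fin.succ) (G.submatrix Fin.succ id) (0 : Matrix (Fin m) (Fin m) ℝ[X])).det.roots =
      ((G.adjugate *ᵥ Pi.single 0 1) ⬝ᵥ (H *ᵥ (G.adjugate *ᵥ Pi.single 0 1))).roots := by
  set ε := (Matrix.fromBlocks (0 : Matrix (Fin (m + 1)) (Fin (m + 1)) ℝ[X]) (1 : Matrix (Fin (m + 1)) (Fin (m + 1)) ℝ[X])
      (1 : Matrix (Fin (m + 1)) (Fin (m + 1)) ℝ[X]) (0 : Matrix (Fin (m + 1)) (Fin (m + 1)) ℝ[X])).det with hε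
  have hε1 : ε * ε = 1 := det_swapBlocks_mul_self
  have hunit : IsUnit ε := IsUnit.of_mul_eq_one ε hε1
  obtain ⟨c, hc, hcε⟩ := Polynomial.isUnit_iff.1 hunit
  have hc0 : c ≠ 0 := hc.ne_zero
  rw [det_theta_eq G H hdet, mul_mul_apply_eq_dotProduct _ _ hG.adjugate 0, ← hε, ← hcε, neg_mul_eq_neg_mul,
    ← Polynomial.C_neg, Polynomial.roots_C_mul _ (neg_ne_zero.2 hc0)]

/-- **Θ is a lacunary pencil on the SAME support.**  For the pencil `G = ∑ₗ X^{dₗ} Sₗ` of size `m+1` and the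
weighted pencil `H = ∑ₗ (cₗ·X^{dₗ}) Sₗ` (e.g. `cₗ = dₗ − e`: `H = X G′ − e G`), the bordered minor
`Θ = [[H, G_{·,succ}], [G_{succ,·}, 0]]`, re-indexed to `Fin (m+1+m)`, is the pencil `∑ₗ X^{dₗ} Θₗ` with letters
`Θₗ = [[cₗ Sₗ, (Sₗ)_{·,succ}], [(Sₗ)_{succ,·}, 0]]`. [this work] -/
theorem theta_eq_pencil {K : ℕ} (d : Fin K → ℕ) (c : Fin K → ℝ) (S : Fin K → Matrix (Fin (m + 1)) (Fin (m + 1)) ℝ) :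
    Matrix.reindex finSumFinEquiv finSumFinEquiv
        (Matrix.fromBlocks (∑ l, (C (c l) * (X : ℝ[X]) ^ d l) • (S l).map C)
          ((∑ l, ((X : ℝ[X]) ^ d l) • (S l).map C).submatrix id Fin.succ)
          ((∑ l, ((X : ℝ[X]) ^ d l) • (S l).map C).submatrix Fin.succ id) (0 : Matrix (Fin m) (Fin m) ℝ[X])) =
      ∑ l, ((X : ℝ[X]) ^ d l) •
        (Matrix.reindex finSumFinEquiv finSumFinEquiv
          (Matrix.fromBlocks (c l • S l) ((S l).submatrix id Fin.succ) ((S l).submatrix Fin.succ id)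
            (0 : Matrix (Fin m) (Fin m) ℝ))).map C := by
  refine Matrix.ext fun x y => ?_
  simp only [Matrix.reindex_apply, Matrix.submatrix_apply, Matrix.sum_apply, Matrix.smul_apply, Matrix.map_apply,
    smul_eq_mul]
  rcases finSumFinEquiv.symm x with i | i <;> rcases finSumFinEquiv.symm y with j | j
  · simp only [Matrix.fromBlocks_apply₁₁, Matrix.sum_apply, Matrix.smul_apply, Matrix.map_apply, smul_eq_mul,
      Polynomial.C_mul]
    exact Finset.sum_congr rfl fun l _ => by ring
  · simp only [Matrix.fromBlocks_apply₁₂, Matrix.submatrix_apply, Matrix.sum_apply, Matrix.smul_apply,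
      Matrix.map_apply, smul_eq_mul, id]
  · simp only [Matrix.fromBlocks_apply₂₁, Matrix.submatrix_apply, Matrix.sum_apply, Matrix.smul_apply,
      Matrix.map_apply, smul_eq_mul, id]
  · simp only [Matrix.fromBlocks_apply₂₂, Matrix.zero_apply, map_zero, mul_zero, Finset.sum_const_zero]

/-- the letters `Θₗ` are symmetric when the `Sₗ` are. [this work] -/
theorem theta_letter_isSymm (c : ℝ) (A : Matrix (Fin (m + 1)) (Fin (m + 1)) ℝ) (hA : A.IsSymm) :
    (Matrix.reindex finSumFinEquiv finSumFinEquiv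
        (Matrix.fromBlocks (c • A) (A.submatrix id Fin.succ) (A.submatrix Fin.succ id)
          (0 : Matrix (Fin m) (Fin m) ℝ))).IsSymm := by
  refine (Matrix.IsSymm.fromBlocks (hA.smul c) ?_ (by simp [Matrix.IsSymm])).submatrix _
  ext i j
  simp only [Matrix.transpose_apply, Matrix.submatrix_apply, id]
  exact hA.apply _ _

/-- **RESIDUAL BUDGET.**  On any support `d`, if every symmetric pencil of size `m+1+m` on `d` has at most `B'` positive
roots of its determinant, then for every symmetric pencil `G = ∑ₗ X^{dₗ} Sₗ` of size `m+1` with `det G ≠ 0` and every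
weight vector `c` (e.g. `cₗ = dₗ − e`), the residual form `uᵀ H u` (`u = adj(G) e₀`, `H = ∑ₗ cₗ X^{dₗ} Sₗ`) has at most
`B'` positive roots: by the bordered-minor identity it is `± det Θ`, `Θ` a symmetric pencil of size `m+1+m` on `d`.
[this work] -/
theorem posRoots_residual_le {K B' : ℕ} (d : Fin K → ℕ) (hB' : PosRootLawOn (m + 1 + m) K B' d)
    (c : Fin K → ℝ) (S : Fin K → Matrix (Fin (m + 1)) (Fin (m + 1)) ℝ) (hS : ∀ l, (S l).IsSymm)
    (hdet : (∑ l, ((X : ℝ[X]) ^ d l) • (S l).map C).det ≠ 0) :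
    ((((∑ l, ((X : ℝ[X]) ^ d l) • (S l).map C).adjugate *ᵥ Pi.single 0 1) ⬝ᵥ
        ((∑ l, (C (c l) * (X : ℝ[X]) ^ d l) • (S l).map C) *ᵥ
          ((∑ l, ((X : ℝ[X]) ^ d l) • (S l).map C).adjugate *ᵥ Pi.single 0 1))).roots.toFinset.filter
      (fun t => 0 < t)).card ≤ B' := by
  have hG : (∑ l, ((X : ℝ[X]) ^ d l) • (S l).map C).IsSymm :=
    Summit.ValiantsHypothesis.ValiantsHypothesis.Theorems.LacunarySymmetroidMatrixDescartes.RolleSchur.pencil_isSymm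
      d S hS
  rw [← roots_det_theta_eq _ _ hG hdet, ← Matrix.det_reindex_self finSumFinEquiv, theta_eq_pencil d c S]
  exact hB' _ (fun l => theta_letter_isSymm (c l) (S l) (hS l))

end OverPolynomials




end Summit.ValiantsHypothesis.ValiantsHypothesis.Theorems.KPlusLogSqLaw.TowerGraft
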